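import Summits.KontsevichZagierPeriods.KontsevichZagierPeriods.Theses.LiouvilleUnfolding
import Literature.NumberTheory.Transcendental.KZLogCalculusProofs

/-!
# Crux `LiouvilleUnfolding.LogPrimitiveNL` (stmt-KontsevichZagierPeriods-2836): boundary rigidity is necessary

Negative-side (cdisprove) support. The unfolding ENGINE of the route is already in the tree
(`KZLogCalculusProofs.lean`: `KZ.unfoldedLogStokes_mem_relations`, `KZlog.Conservative_holds`,
`KZ.of_sub_of_mem_relations_fibreSubst`, `KZ.of_sub_of_sub_mem_relations_mul`, …); modulo it the
crux is a statement about the BASE only, typed here as `BoundaryRigidity`: for `ℚ`-semialgebraic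
`hᵢ`, `Wᵢ ≥ 1` on a base such that the FUNCTION `Σ hᵢ log Wᵢ` is the integrand of an honest
representation `g`, the unfolded monomials `Uᵢ = [{1 ≤ u ≤ Wᵢ x}, hᵢ x/u]` satisfy
`Σ [Uᵢ] − [g] ∈ KZ.relations` (the semantic identification of a logarithmic term with a semialgebraic
function — "constants collapse" — restricted to terms whose function is semialgebraic; its content is
Ax–Schanuel + Baker, see the work file
`Summits/KontsevichZagierPeriods/KontsevichZagierPeriods/Cruxes/LogPrimitiveNL/Disproof.lean`, §7).

`boundaryRigidity_of_crux : LogPrimitiveNL → BoundaryRigidity`: apply the crux on the band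
`base × [0,1]` with `Vᵢ = 1 + t (Wᵢ − 1)`, split the band representation into its summands and carry
each onto `Uᵢ` by the fibrewise substitution. Hence a counterexample to `BoundaryRigidity` refutes
the crux.
-/

noncomputable section

open Set MeasureTheory
open Literature.NumberTheory.Transcendental

namespace Summit.KontsevichZagierPeriods.LiouvilleUnfolding.LogPrimitiveNL.Negative

open Summit.KontsevichZagierPeriods.KontsevichZagierPeriods.Theses.LiouvilleUnfolding (LogPrimitiveNL)

/-- **BOUNDARY RIGIDITY** (the residual content of the crux modulo the tree engine; work file Disproof.lean §7.3): over a
`ℚ`-semialgebraic base (`g.domain`), for `ℚ`-semialgebraic `hᵢ` and `Wᵢ ≥ 1`, if the FUNCTION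
`Σᵢ hᵢ · log Wᵢ` is the integrand of an honest representation `g`, then the unfolded monomials
`Uᵢ = [{(x,u) | x ∈ g.domain, 1 ≤ u ≤ Wᵢ x}, hᵢ x/u]` satisfy `Σᵢ [Uᵢ] − [g] ∈ KZ.relations`.
`LogPrimitiveNL ⇒ BoundaryRigidity` by `KZ.of_sub_of_mem_relations_fibreSubst` (take `a = 0`, `b = 1`,
`Vᵢ = 1 + t (Wᵢ − 1)`); `BoundaryRigidity ⇒ LogPrimitiveNL` by `KZ.unfoldedLogStokes_mem_relations`
after the renormalisation of the work file, §7.2(b). Expected TRUE (Ax–Schanuel + Baker, both proved in tree). -/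
def BoundaryRigidity : Prop :=
  ∀ (n k : ℕ) (g : KZ.IntegralRep n) (h W : Fin k → (Fin n → ℝ) → ℝ)
    (U : Fin k → KZ.IntegralRep (n + 1)),
    (∀ i, IsSemialgebraicFunOn ℚ g.domain (h i)) →
    (∀ i, IsSemialgebraicFunOn ℚ g.domain (W i)) →
    (∀ i, ∀ x ∈ g.domain, 1 ≤ W i x) →
    (∀ i, (U i).domain = {z | (Fin.init z : Fin n → ℝ) ∈ g.domain ∧ 1 ≤ z (Fin.last n) ∧
      z (Fin.last n) ≤ W i (Fin.init z)}) →
    (∀ i, EqOn (U i).integrand (fun z => h i (Fin.init z) / z (Fin.last n)) (U i).domain) →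
    (∀ i, IntegrableOn (fun x => h i x * Real.log (W i x)) g.domain) →
    (∀ x ∈ g.domain, g.integrand x = ∑ i, h i x * Real.log (W i x)) →
    ∑ i, KZ.of (U i) - KZ.of g ∈ KZ.relations

/-- **The crux implies boundary rigidity** (so a counterexample to `BoundaryRigidity` refutes the
crux, and the typed target is not stronger than the crux). Given BR data, the crux is applied to the
band `g.domain × [0, 1]` with `Vᵢ(x, t) = 1 + t (Wᵢ x − 1)` (`Vᵢ' = Wᵢ − 1`, `hᵢVᵢ'/Vᵢ` = the box
integrand of `KZ.isSemialgebraicFunOn_box₁` / `KZ.integrableOn_box₁`), whose boundary term is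
`Σ hᵢ log Wᵢ = g.integrand`; the band representation `[box, Σᵢ hᵢ(Wᵢ−1)/(1+t(Wᵢ−1))]` is split into
its summands (`KZ.of_sub_of_sub_sum_mem_relations`) and each summand is carried onto the unfolded
monomial `Uᵢ` by the fibrewise substitution `KZ.of_sub_of_mem_relations_fibreSubst` (tree engine). -/
theorem boundaryRigidity_of_crux (hc : LogPrimitiveNL) : BoundaryRigidity := by
  intro n k g h W U hh hW hW1 hUd hUi hUint hg
  have hS : Literature.ModelTheory.ExponentialFields.IsSemialgebraic ℚ g.domain :=
    g.isSemialgebraic_domain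
  have hSm : MeasurableSet g.domain := KZ.IntegralRep.measurableSet_domain_holds g
  -- `cᵢ = Wᵢ − 1 ≥ 0`
  have hcsa : ∀ i, IsSemialgebraicFunOn ℚ g.domain (fun x => W i x - 1) := fun i =>
    (IsSemialgebraicFunOn.sub_holds (hW i) (isSemialgebraicFunOn_ratCast hS 1)).congr
      fun x _ => by simp
  have hc0 : ∀ i, ∀ x ∈ g.domain, 0 ≤ W i x - 1 := fun i x hx => sub_nonneg.2 (hW1 i x hx)
  -- the box over the base
  have hQ : Literature.ModelTheory.ExponentialFields.IsSemialgebraic ℚ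
      (KZlog.band g.domain (fun _ => (0 : ℝ)) (fun _ => 1)) :=
    KZlog.isSemialgebraic_band (by simpa using isSemialgebraicFunOn_ratCast hS 0)
      (by simpa using isSemialgebraicFunOn_ratCast hS 1)
  have hlogint : ∀ i, IntegrableOn (fun y => h i y * Real.log (1 + (W i y - 1))) g.domain :=
    fun i => (hUint i).congr_fun (fun y _ => by simp) hSm
  -- the box representations `R₂ i = [box, hᵢ cᵢ/(1 + t cᵢ)]`
  let R₂ : Fin k → KZ.IntegralRep (n + 1) := fun i =>
    { domain := KZlog.band g.domain (fun _ => (0 : ℝ)) (fun _ => 1)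
      integrand := fun w => h i (Fin.init w) * (W i (Fin.init w) - 1) /
        (1 + w (Fin.last n) * (W i (Fin.init w) - 1))
      isSemialgebraic_domain := hQ
      isSemialgebraicFunOn_integrand := KZ.isSemialgebraicFunOn_box₁ hS (hh i) (hcsa i) (hc0 i)
      integrableOn := KZ.integrableOn_box₁ hS (hh i) (hcsa i) (hc0 i) (hlogint i) }
  -- fibrewise substitution, termwise (tree engine)
  have hfs : ∀ i, KZ.of (U i) - KZ.of (R₂ i) ∈ KZ.relations := fun i =>
    KZ.of_sub_of_mem_relations_fibreSubst hS (hW i) (hW1 i) (U i) (R₂ i) (hUd i) (hUi i) rfl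
      fun w _ => rfl
  -- the band representation of the crux instance and its splitting
  let r : KZ.IntegralRep (n + 1) :=
    { domain := KZlog.band g.domain (fun _ => (0 : ℝ)) (fun _ => 1)
      integrand := fun w => ∑ i, (R₂ i).integrand w
      isSemialgebraic_domain := hQ
      isSemialgebraicFunOn_integrand :=
        KZ.isSemialgebraicFunOn_finset_sum _ hQ fun i _ => (R₂ i).isSemialgebraicFunOn_integrand
      integrableOn := integrable_finsetSum _ fun i _ => (R₂ i).integrableOn }
  obtain ⟨z0, hz0d, hz0i⟩ := KZ.exists_zeroRep hQ
  have hsplit : KZ.of r - KZ.of z0 - ∑ i, KZ.of (R₂ i) ∈ KZ.relations :=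
    KZ.of_sub_of_sub_sum_mem_relations k r z0 R₂ hz0d (fun _ => rfl) fun w _ => by
      simp [hz0i, r]
  have hz0 : KZ.of z0 ∈ KZ.relations :=
    KZ.of_mem_relations_of_eqOn_zero z0 fun w _ => by simp [hz0i]
  -- the crux, applied with `Vᵢ = 1 + t (Wᵢ − 1)`, `Vᵢ' = Wᵢ − 1`, `a = 0`, `b = 1`
  have hcrux : KZ.of r - KZ.of g ∈ KZ.relations := by
    refine hc n k r g (fun _ => 0) (fun _ => 1) h
      (fun i z => 1 + z (Fin.last n) * (W i (Fin.init z) - 1)) (fun i z => W i (Fin.init z) - 1)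
      (by simpa using isSemialgebraicFunOn_ratCast hS 0)
      (by simpa using isSemialgebraicFunOn_ratCast hS 1)
      (fun _ _ => zero_le_one) rfl hh (fun i => ?_) (fun i z hz => ?_) (fun i x _ => ?_)
      (fun i x _ t _ => ?_) (fun i => (R₂ i).integrableOn) (fun x _ t _ => ?_) (fun x hx => ?_)
    · exact (IsSemialgebraicFunOn.add_holds (isSemialgebraicFunOn_ratCast hQ 1)
        (IsSemialgebraicFunOn.mul_holds (isSemialgebraicFunOn_apply hQ (Fin.last n))
          ((hcsa i).comp_init_mono hQ KZ.band_subset_setOf_init_mem))).congr fun w _ => by simp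
    · have h0 : 0 ≤ z (Fin.last n) := hz.2.1
      have h1 : 0 ≤ W i (Fin.init z) - 1 := hc0 i _ hz.1
      show 0 < 1 + z (Fin.last n) * (W i (Fin.init z) - 1)
      positivity
    · simp only [Fin.snoc_last, Fin.init_snoc]
      exact continuousOn_const.add (continuousOn_id.mul continuousOn_const)
    · simp only [Fin.snoc_last, Fin.init_snoc]
      exact (((hasDerivAt_id' t).mul_const (W i x - 1)).const_add 1).congr_deriv (by ring)
    · simp [r, R₂]
    · rw [hg x hx]
      refine Finset.sum_congr rfl fun i _ => ?_
      simp
  -- assembly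
  have hA : ∑ i, (KZ.of (U i) - KZ.of (R₂ i)) ∈ KZ.relations :=
    AddSubgroup.sum_mem _ fun i _ => hfs i
  have e : ∑ i, KZ.of (U i) - KZ.of g =
      (∑ i, (KZ.of (U i) - KZ.of (R₂ i))) - (KZ.of r - KZ.of z0 - ∑ i, KZ.of (R₂ i)) +
        (KZ.of r - KZ.of g) - KZ.of z0 := by
    rw [Finset.sum_sub_distrib]
    abel
  rw [e]
  exact KZ.relations.sub_mem (KZ.relations.add_mem (KZ.relations.sub_mem hA hsplit) hcrux) hz0


end Summit.KontsevichZagierPeriods.LiouvilleUnfolding.LogPrimitiveNL.Negative
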